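import Summits.ResolutionOfSingularities.ResolutionOfSingularities.Theorems.UniformComplexityCampaignW82TwistExponentCusp
import Summits.ResolutionOfSingularities.ResolutionOfSingularities.Theorems.UniformComplexityCampaignW82HypersurfaceBaseChange
import Summits.ResolutionOfSingularities.ResolutionOfSingularities.Theorems.UniformComplexityCampaignW82FamilyResolution
import Mathlib.AlgebraicGeometry.Morphisms.SchemeTheoreticallyDominant
import Mathlib.AlgebraicGeometry.Morphisms.Flat
import Mathlib.RingTheory.TensorProduct.Quotient
import Mathlib.RingTheory.TensorProduct.MvPolynomial
import HarnessLib

/-!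
# [OURS · L1 W8.2] Separable tightness of resolution in families — the Kollár pencil over a ring, and
# integrality along flat base change from a dense piece

Cell `res-hironaka` (run/shared/lean/pub/res-hironaka/), LADDER-RESOLUTION rung L (RESCUE), slot W8.2, door 2
(`UniformComplexity`, host item `PrimeModelTransfer` stmt-ResolutionOfSingularities-8933); prover res-L1-s82-pv-2
(gen 7). THESES-FREE support module (imports the gen-3/gen-4 siblings `…TwistExponentCusp` (the curves
`TwistExponent.twistCurve`), `…HypersurfaceBaseChange` (`TwistNormal.specIsoOfRingEquiv`), the OURS vocabulary
`…FamilyResolution`, Mathlib, `HarnessLib`). Objects and two lemmas for the separable-tightness theorem of the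
family form (sibling files `…SeparableTightnessCore` p555296, `…SeparableTightnessTwoFibres`,
`…SeparableTightness`; OURS statement `CampaignW82.FamilyResolutionSep`, p554368).

CONTENT.
* §1 THE KOLLÁR PENCIL over a commutative ring `A` with a marked element `t ∈ A`:
  `pencil A p t q = Spec A[x,y]/(y^q − (x^p − t)) → Spec A`, a family of plane curves; its base change along
  any ring map `φ : A → L` to a field is Kollár's curve `C_1(L, φ t) = TwistExponent.twistCurve L p (φ t) q 1`
  of the gen-3 files (`pullbackPencilIso`, over `Spec L`: `pullbackPencilIso_hom_comp`), hence integral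
  (`isIntegral_pullback_pencil`).
* §2 INTEGRALITY SPREADS FROM A DENSE PIECE ALONG FLAT BASE CHANGE (`isIntegral_of_flat_of_isPullback`): if
  `j : U → X` is quasi-compact and scheme-theoretically dominant (e.g. a dense open immersion into a reduced
  scheme), `b : X̃ → X` is flat and `U ×_X X̃` is integral, then `X̃` is integral (Mathlib: scheme-theoretic
  dominance survives flat base change and detects reducedness; dominance gives irreducibility). This is how
  the headline file certifies «integral geometric generic fibre» for the compactified pencil, and how the
  two-fibre file certifies irreducibility of the generic fibre after a separable base extension.

HONEST FRAMING. OURS negative-side bookkeeping for the campaign statement `CampaignW82.FamilyResolutionSep`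
(p554368); NOT a statement of H. Hironaka's 2017 manuscript ([Hironaka2017]); nothing here is attributed to its
author. AI work, weaker than expert review.

## References (vocabulary and locators only)
* J. Kollár, *Lectures on Resolution of Singularities* (2007), 1.19. [Kollar2007]
* The Stacks Project, Tags 01JY (base change of affine schemes), 081H/0CMK (scheme-theoretically dense, flat
  base change). [StacksProject]
-/

noncomputable section

set_option linter.dupNamespace false -- mandated namespace of this single-conjunct summit

open Polynomial TensorProduct
open _root_.CategoryTheory _root_.CategoryTheory.Limits _root_.AlgebraicGeometry _root_.TopologicalSpace
open Literature.AlgebraicGeometry.Resolution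

namespace Summit.ResolutionOfSingularities.ResolutionOfSingularities.Theorems.CampaignW82.SeparableTightness

/-! ## §1 The Kollár pencil over a ring -/

section Pencil

variable (A : Type) [CommRing A] (p : ℕ) (t : A) (q : ℕ)

/-- `y^q − (x^p − t)^1 ∈ A[x,y]` (`X₀ = y`, `X₁ = x`), written so that its image under a ring map `φ : A → L`
is literally the gen-3 `TwistExponent.twistPoly L p (φ t) q 1`. [folklore] -/
def pencilPoly : MvPolynomial (Fin 2) A :=
  MvPolynomial.X 0 ^ q - (MvPolynomial.X 1 ^ p - MvPolynomial.C t) ^ 1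

/-- The coordinate ring `A[x,y]/(y^q − (x^p − t))` of the pencil. [folklore] -/
abbrev PencilRing : Type := MvPolynomial (Fin 2) A ⧸ Ideal.span {pencilPoly A p t q}

/-- **The Kollár pencil** `Spec A[x,y]/(y^q − (x^p − t)) → Spec A`: over `A = k[t]` the family of plane
curves whose fibre over `t ∉ (residue field)^p` is Kollár's regular non-smooth curve. [cite: Kollar2007, 1.19] -/
abbrev pencil : Scheme.{0} := Spec (.of (PencilRing A p t q))

/-- Its structure morphism. [folklore] -/
abbrev pencilTo : pencil A p t q ⟶ Spec (.of A) :=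
  Spec.map (CommRingCat.ofHom (algebraMap A (PencilRing A p t q)))

/-- The pencil is locally of finite type over `Spec A`. [folklore] -/
theorem locallyOfFiniteType_pencilTo : LocallyOfFiniteType (pencilTo A p t q) := by
  rw [HasRingHomProperty.Spec_iff (P := @LocallyOfFiniteType), CommRingCat.hom_ofHom,
    RingHom.finiteType_algebraMap]
  infer_instance

variable {A} {L : Type} [Field L]

/-- Under a ring map `φ : A → L`, `y^q − (x^p − t) ↦ ` `TwistExponent.twistPoly L p (φ t) q 1`. [folklore] -/
theorem map_pencilPoly (φ : A →+* L) :
    MvPolynomial.map φ (pencilPoly A p t q) = TwistExponent.twistPoly L p (φ t) q 1 := by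
  simp [pencilPoly, TwistExponent.twistPoly, MvPolynomial.map_X, MvPolynomial.map_C]

variable (A)

/-- `L ⊗_A A[x,y]/(y^q − (x^p − t)) ≅ L[x,y]/(y^q − (x^p − φ t))` as `L`-algebras (Mathlib's
`Algebra.TensorProduct.tensorQuotientEquiv` and `MvPolynomial.algebraTensorAlgEquiv`). [folklore] -/
def pencilTensorEquivL [Algebra A L] :
    L ⊗[A] PencilRing A p t q ≃ₐ[L] TwistExponent.TwistRing L p (algebraMap A L t) q 1 :=
  (Algebra.TensorProduct.tensorQuotientEquiv (R := A) L (MvPolynomial (Fin 2) A) L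
      (Ideal.span {pencilPoly A p t q})).trans
    (Ideal.quotientEquivAlg _ _ (MvPolynomial.algebraTensorAlgEquiv A L) (by
      rw [Ideal.map_span, Set.image_singleton, Ideal.map_span, Set.image_singleton, ← map_pencilPoly]
      congr 1
      ext1
      simp [Algebra.TensorProduct.includeRight_apply]))

/-- The same with the factors swapped (as delivered by `pullbackSpecIso`), as a ring isomorphism. [folklore] -/
def pencilTensorEquiv [Algebra A L] :
    PencilRing A p t q ⊗[A] L ≃+* TwistExponent.TwistRing L p (algebraMap A L t) q 1 :=
  (Algebra.TensorProduct.comm A (PencilRing A p t q) L).toRingEquiv.trans (pencilTensorEquivL A p t q).toRingEquiv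

/-- `pencilTensorEquiv` is `L`-linear on constants: `1 ⊗ l ↦ l`. [folklore] -/
theorem pencilTensorEquiv_one_tmul [Algebra A L] (l : L) :
    pencilTensorEquiv A p t q (L := L) (1 ⊗ₜ l) =
      algebraMap L (TwistExponent.TwistRing L p (algebraMap A L t) q 1) l := by
  have h0 : l ⊗ₜ[A] (1 : PencilRing A p t q) = l • ((1 : L) ⊗ₜ[A] (1 : PencilRing A p t q)) := by
    rw [TensorProduct.smul_tmul', smul_eq_mul, mul_one]
  change pencilTensorEquivL A p t q ((Algebra.TensorProduct.comm A (PencilRing A p t q) L) (1 ⊗ₜ l)) = _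
  rw [Algebra.TensorProduct.comm_tmul, h0, map_smul, ← Algebra.TensorProduct.one_def, map_one,
    ← Algebra.algebraMap_eq_smul_one]

/-- **Base change of the pencil along `φ : A → L` (a field) is Kollár's curve `C_1(L, φ t)`**:
`pencil ×_{Spec A, φ} Spec L ≅ Spec (A[x,y]/(f) ⊗_A L) ≅ Spec L[x,y]/(y^q − (x^p − φ t))`. [folklore] -/
def pullbackPencilIso (φ : A →+* L) :
    pullback (pencilTo A p t q) (Spec.map (CommRingCat.ofHom φ)) ≅
      TwistExponent.twistCurve L p (φ t) q 1 :=
  letI : Algebra A L := φ.toAlgebra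
  pullbackSpecIso A (PencilRing A p t q) L ≪≫ TwistNormal.specIsoOfRingEquiv (pencilTensorEquiv A p t q (L := L))

/-- The base-change isomorphism lies over `Spec L`. [folklore] -/
theorem pullbackPencilIso_hom_comp (φ : A →+* L) :
    (pullbackPencilIso A p t q φ).hom ≫ TwistExponent.twistCurveTo L p (φ t) q 1 =
      pullback.snd (pencilTo A p t q) (Spec.map (CommRingCat.ofHom φ)) := by
  letI : Algebra A L := φ.toAlgebra
  letI : Algebra L (PencilRing A p t q ⊗[A] L) := Algebra.TensorProduct.rightAlgebra
  have h := TwistNormal.specIsoOfRingEquiv_hom_comp (K := L) (A := PencilRing A p t q ⊗[A] L)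
    (B := TwistExponent.TwistRing L p (φ t) q 1) (pencilTensorEquiv A p t q (L := L))
    (fun l => by
      change pencilTensorEquiv A p t q (L := L) (1 ⊗ₜ l) = _
      exact pencilTensorEquiv_one_tmul A p t q l)
  rw [show (pullbackPencilIso A p t q φ).hom = (pullbackSpecIso A (PencilRing A p t q) L).hom ≫
      (TwistNormal.specIsoOfRingEquiv (pencilTensorEquiv A p t q (L := L))).hom from rfl, Category.assoc, h]
  exact pullbackSpecIso_hom_snd A (PencilRing A p t q) L

/-- The pencil's base change to a field is an integral scheme (`y^q − (x^p − c)` is prime for every `c`,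
gen 3 `TwistExponent.isDomain_twistRing`). [folklore] -/
theorem isIntegral_pullback_pencil [Fact p.Prime] [Fact q.Prime] (hqp : q ≠ p) (φ : A →+* L) :
    IsIntegral (pullback (pencilTo A p t q) (Spec.map (CommRingCat.ofHom φ))) := by
  haveI : IsDomain (TwistExponent.TwistRing L p (φ t) q 1) :=
    TwistExponent.isDomain_twistRing (K := L) (t := φ t) hqp (N := 1)
      (fun h => (Fact.out : q.Prime).ne_one (Nat.dvd_one.mp h))
  haveI : Nonempty ↥(pullback (pencilTo A p t q) (Spec.map (CommRingCat.ofHom φ))) :=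
    ⟨(pullbackPencilIso A p t q φ).inv (⊥ : PrimeSpectrum _)⟩
  exact isIntegral_of_isOpenImmersion (pullbackPencilIso A p t q φ).hom

end Pencil

/-! ## §2 Integrality spreads from a scheme-theoretically dense quasi-compact open along flat base change -/

/-- **Integrality along flat base change from a dense piece.** Let `j : U → X` be quasi-compact and
scheme-theoretically dominant (e.g. a dense open immersion into a reduced scheme), `b : X̃ → X` flat, and
`P = U ×_X X̃` (a pullback square `IsPullback b' j̃ j b`). If `P` is an integral scheme then so is `X̃`:
the base change `j̃ : P → X̃` is scheme-theoretically dominant (flatness of `b`, Mathlib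
`IsSchemeTheoreticallyDominant.of_isPullback`) and quasi-compact, hence `X̃` is reduced
(`IsSchemeTheoreticallyDominant.isReduced`) and, `j̃` being dominant with irreducible source, irreducible.
[cite: StacksProject, Tag 0CMK] -/
theorem isIntegral_of_flat_of_isPullback {U X X' P : Scheme.{0}} (j : U ⟶ X) [QuasiCompact j]
    [IsSchemeTheoreticallyDominant j] (b : X' ⟶ X) [Flat b] {b' : P ⟶ U} {j' : P ⟶ X'}
    (H : IsPullback b' j' j b) [IsIntegral P] : IsIntegral X' := by
  haveI : IsSchemeTheoreticallyDominant j' := IsSchemeTheoreticallyDominant.of_isPullback H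
  haveI : QuasiCompact j' := MorphismProperty.of_isPullback (P := @QuasiCompact) H inferInstance
  haveI : IsReduced X' := IsSchemeTheoreticallyDominant.isReduced j'
  haveI : Nonempty X' := ⟨j' (Classical.arbitrary P)⟩
  haveI : IrreducibleSpace X' := by
    rw [irreducibleSpace_def]
    have h1 : IsIrreducible (Set.range j') := by
      rw [← Set.image_univ]
      exact (IrreducibleSpace.isIrreducible_univ P).image _ j'.continuous.continuousOn
    have h2 := h1.closure
    rwa [j'.denseRange.closure_range] at h2
  exact isIntegral_of_irreducibleSpace_of_isReduced X'

end Summit.ResolutionOfSingularities.ResolutionOfSingularities.Theorems.CampaignW82.SeparableTightness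

end
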